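import Literature.AlgebraicGeometry.HodgeTheory.MiddleDimensionReductionHolds
import Summits.HodgeConjecture.HodgeConjecture.Theorems.LimitExtensionHypersurfacesSufficeOfLE
import Summits.HodgeConjecture.HodgeConjecture.Theorems.LimitExtensionMiddleDivisorSupportSuffices
import Literature.AlgebraicGeometry.HodgeTheory.DivisorInduction
import Literature.AlgebraicGeometry.HodgeTheory.GysinKernelSplit
import Literature.AlgebraicGeometry.HodgeTheory.HodgeRiemannPolarizability
import Literature.AlgebraicGeometry.HodgeTheory.ComplexConjugationHolds
import Literature.NumberTheory.Transcendental.DeRhamTheoremMultiplicative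

/-!
# Route LimitExtension · `Assembly` (stmt-HodgeConjecture-10868) — the down-step it needs is exactly
# "one below the middle in odd dimension"; the item on the leaves of the fact DAG

The assembly item `Assembly := HodgeModels (inline) → LimitExtensionMid → HypersurfaceHodge →
HodgeConjecture` is, by `limitExtension_assembly_of`, the composition of `PullbackGlue`
(stmt-HodgeConjecture-2999, from the specialisation lemma stmt-HodgeConjecture-2998 by
`limitExtension_pullbackGlue_of_specialisation`) and `MiddleDivisorSupportSuffices`
(stmt-HodgeConjecture-10865: Thomas's induction on the dimension — the divisor descent plus the
Lefschetz-pencil step BELOW the middle, `middleDivisorSupportSuffices_of_nodalSupport`).  This file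
sharpens the second gap for THIS route and records the item on the leaves of the tree's fact DAG.

* `limitExtension_assembly_of_divisorInduction_of_oddBelowMiddle` (through
  `limitExtension_middleDivisorSupportSuffices_of_divisorInduction_of_oddBelowMiddle`) — granted the
  specialisation lemma (`hS`) and the divisor induction (`hDI`, verbatim the body of `NodalSupport` /
  `LinearSystemTorelli`'s `DivisorInduction`, stmt-HodgeConjecture-1082), the ONLY further input the
  item needs is the Hodge conjecture ONE BELOW THE MIDDLE IN ODD DIMENSION: rational `(k,k)`-classes
  in `H^{2k}(Y(ℂ); ℂ)` of smooth projective `(2k+1)`-folds `Y` are algebraic (`hG`).  Proof: by BFNP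
  Lemma 48 (`middleDimensionReduction_holds`, a THEOREM of the tree) only middle classes on
  `2m`-folds matter (`hodgeConjectureFor_of_middleDimension_holds`); such a class is supported on a
  divisor
  by `PullbackGlue` (limit extension + HC on the smooth hypersurface fibres + specialisation), and
  the divisor induction at `(n, p) = (2m - 1, m)` asks precisely for HC in codimension `m - 1` on
  `(2m-1)`-folds — the instance `k = m - 1` of `hG`.  No pencil schema `∀ m p, …` is consumed: of
  Thomas's down-step this route uses one diagonal only.
* `limitExtension_middleDivisorSupportSuffices_of_divisorInduction_of_oddBelowMiddle`,
  `limitExtension_middleDivisorSupportSuffices_iff_oddBelowMiddle` — the same for the registered dep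
  `MiddleDivisorSupportSuffices` (stmt-HodgeConjecture-10865) on its own: modulo `hDI`,
  `MiddleDivisorSupportSuffices ↔ (MiddleDivisorSupport → [HC one below the middle in odd
  dimension])` (the dual of BFNP's "middle degree of even-dimensional varieties suffices",
  `limitExtension_middleDivisorSupportSuffices_iff` of `Theorems/LimitExtensionAssembly`).
* `limitExtension_assembly_iff_oddBelowMiddle` — consequently, modulo `hS` and `hDI` (two theorems
  in print), `Assembly ↔ (LimitExtensionMid → HypersurfaceHodge → [HC one below the middle in odd
  dimension])`: the residual content of the item beyond its own two cruxes is this single family of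
  instances of the Hodge conjecture (`k = 0` trivial; `k = 1`: divisor classes on threefolds —
  Lefschetz `(1,1)`, the named fact `lefschetzOneOne_rational`; `k ≥ 2`: codimension-`k` cycles on
  `(2k+1)`-folds, open — in Thomas's scheme the output of the Lefschetz-pencil step
  `PencilReduction`, stmt-HodgeConjecture-1083, at `(m, p) = (2k, k)`).
* `limitExtension_assembly_of_leaves` / `limitExtension_assembly_of_leaves_of_pencilReduction` —
  the item from the LEAVES of the tree's fact DAG: Deligne *Hodge III* Prop. 8.2.7
  (`Deligne1974_ker_pullback_eq_ker_pullback_resolution` ⟹ Cor. 8.2.8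
  `Deligne1974_ker_restrictCompl_eq_iSup_range_complexGysin_holds_of` ⟹ the divisor induction
  `divisorInduction_of_deligne_of_hodgeClassLift`), the polarizability of the Hodge structures of
  smooth projective varieties (`smoothProjective_hodgeStructure_isPolarizable` ⟹ Voisin 2025
  Cor. 2.12 `Voisin2025_hodgeClass_lift_complexGysin_holds_of`, with the PROVED real Hodge models
  `exists_isReal_hodgeModel_holds` and de Rham theorem `exists_deRhamIsoFamily_holds`), the route's
  specialisation lemma (stmt-HodgeConjecture-2998), and either `hG` or the pencil step
  (`PencilReduction`, stmt-HodgeConjecture-1083, verbatim body, through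
  `middleDivisorSupportSuffices_of_facts`).

STATUS: CONDITIONAL (supports the item, does not close it).  CLOSING RECIPE: with
`specialisationOfAlgebraicity_proof : SpecialisationOfAlgebraicity` (2998), discharges `h827_holds`,
`hpol_holds` of the two facts, and a proof `g` of the odd-below-middle family (or `pen` of the body
of `PencilReduction`): `theorem limitExtension_assembly_proof : Assembly :=
limitExtension_assembly_of_leaves h827_holds hpol_holds specialisationOfAlgebraicity_proof g`
(`--workitem stmt-HodgeConjecture-10868`), then release the item `--by` it.
-/

-- `Summit.HodgeConjecture.HodgeConjecture.Theorems` is the mandated namespace (single-problem summit: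
-- Problem = Summit), which `linter.dupNamespace` flags on every declaration; the lakefile turns the
-- linter off for the Summits library (weak option), restated here so stand-alone elaboration is warning-free.
set_option linter.dupNamespace false

noncomputable section

namespace Summit.HodgeConjecture.HodgeConjecture.Theorems

open Summit.HodgeConjecture.HodgeConjecture.Theses.LimitExtension
open Literature.AlgebraicGeometry Literature.AlgebraicGeometry.HodgeTheory
  Literature.AlgebraicGeometry.Motives CategoryTheory
open scoped Manifold

/-- **`MiddleDivisorSupportSuffices` modulo the divisor induction and HC one below the middle in
odd dimension** (item stmt-HodgeConjecture-10865 sharpened: of Thomas's Lefschetz-pencil step below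
the middle only the diagonal `(m, p) = (2k, k)` is consumed).  Hypotheses: `hDI` — the divisor
induction, verbatim the body of `DivisorInduction` (stmt-HodgeConjecture-1082: for `1 ≤ p`, HC in
codimension `p - 1` for `n`-folds ⟹ on `(n+1)`-folds rational `(p,p)`-classes supported on a
divisor are algebraic; Deligne Hodge III Cor. 8.2.8 + semisimplicity, in the tree
`divisorInduction_of_deligne_of_hodgeClassLift`); `hG` — for every `k`, every rational `(k,k)`-class
in `H^{2k}(Y(ℂ); ℂ)` of a smooth projective `(2k+1)`-fold `Y` is algebraic.  Proof: by
`hodgeConjectureFor_of_middleDimension_holds` (BFNP Lemma 48, proved in the tree; Hodge models by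
`nonempty_hodgeModel_holds`) it suffices to treat a rational middle `(m,m)`-class `c` on a smooth
projective `2m`-fold; `m = 0` is `algebraicClasses X 0 = ⊤`; for `m = m' + 1`,
`MiddleDivisorSupport` puts `c` in `N¹H^{2m}`, and `hDI` at `(n, p) = (2m' + 1, m' + 1)`, fed with
`hG` at `k = m'`, makes it algebraic. [cite: Thomas2005Nodes, Prop. 2 (proof)]
[cite: BrosnanFangNiePearlstein2009, §6 Lemma 48] [cite: DeligneHodgeIII1974, Cor. 8.2.8] -/
theorem limitExtension_middleDivisorSupportSuffices_of_divisorInduction_of_oddBelowMiddle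
    (hDI : ∀ (n p : ℕ), 1 ≤ p →
      (∀ ⦃Y : SchemeOver ℂ⦄, IsSmoothProjective n Y → ∀ c : complexBetti Y (2 * (p - 1)),
        IsRationalClass c → IsOfHodgeType n Y (2 * (p - 1)) (p - 1) (p - 1) c →
          c ∈ algebraicClasses Y (p - 1)) →
      ∀ ⦃X : SchemeOver ℂ⦄, IsSmoothProjective (n + 1) X → ∀ c : complexBetti X (2 * p),
        IsRationalClass c → IsOfHodgeType (n + 1) X (2 * p) p p c →
          c ∈ supportedClasses X (2 * p) 1 → c ∈ algebraicClasses X p)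
    (hG : ∀ ⦃k : ℕ⦄ ⦃Y : SchemeOver ℂ⦄, IsSmoothProjective (2 * k + 1) Y →
      ∀ c : complexBetti Y (2 * k), IsRationalClass c → IsOfHodgeType (2 * k + 1) Y (2 * k) k k c →
        c ∈ algebraicClasses Y k) :
    MiddleDivisorSupportSuffices := by
  -- by BFNP Lemma 48 (`hodgeConjectureFor_of_middleDimension_holds`) only middle classes matter
  intro _ hMDS n X₀ hX₀
  refine hodgeConjectureFor_of_middleDimension_holds (fun m X hX c hc hmm ↦ ?_) hX₀
  rcases Nat.eq_zero_or_pos m with h0 | hpos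
  · subst h0
    exact hodgeConjectureFor_codim_zero c
  · -- `m = m' + 1 ≥ 1`: divisor support by `MiddleDivisorSupport`, then the divisor induction at
    -- `(n, p) = (2m' + 1, m' + 1)`, whose input is `hG` at `k = m'`
    obtain ⟨m', rfl⟩ : ∃ m', m = m' + 1 := ⟨m - 1, by omega⟩
    have hsupp : c ∈ supportedClasses X (2 * (m' + 1)) 1 := hMDS (by omega) hX c hc hmm
    -- `hG` at `k = m'`, with the index written `m' + 1 - 1` as the divisor induction expects it
    have hHC : ∀ q : ℕ, q = m' → ∀ ⦃Y : SchemeOver ℂ⦄, IsSmoothProjective (2 * m' + 1) Y →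
        ∀ c' : complexBetti Y (2 * q), IsRationalClass c' →
          IsOfHodgeType (2 * m' + 1) Y (2 * q) q q c' → c' ∈ algebraicClasses Y q := by
      rintro q rfl Y hY c' hc' hH'
      exact hG hY c' hc' hH'
    have hX' : IsSmoothProjective (2 * m' + 1 + 1) X := by
      rw [show 2 * m' + 1 + 1 = 2 * (m' + 1) by ring]; exact hX
    have hmm' : IsOfHodgeType (2 * m' + 1 + 1) X (2 * (m' + 1)) (m' + 1) (m' + 1) c := by
      rw [show 2 * m' + 1 + 1 = 2 * (m' + 1) by ring]; exact hmm
    exact hDI (2 * m' + 1) (m' + 1) (by omega) (hHC (m' + 1 - 1) (by omega)) hX' c hc hmm' hsupp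

/-- **The item modulo the specialisation lemma, the divisor induction, and HC one below the middle
in odd dimension.**  Hypotheses: `hS` — the route's support `SpecialisationOfAlgebraicity`
(stmt-HodgeConjecture-2998); `hDI` — the divisor induction, verbatim the body of `DivisorInduction`
(stmt-HodgeConjecture-1082: for `1 ≤ p`, HC in codimension `p - 1` for `n`-folds ⟹ on `(n+1)`-folds
rational `(p,p)`-classes supported on a divisor are algebraic; Deligne Hodge III Cor. 8.2.8 +
semisimplicity, in the tree `divisorInduction_of_deligne_of_hodgeClassLift`); `hG` — for every `k`,
every rational `(k,k)`-class in `H^{2k}(Y(ℂ); ℂ)` of a smooth projective `(2k+1)`-fold `Y` is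
algebraic.  Conclusion: `Assembly` — the planner's composition `fun m a b ↦ h₈ m (h₇ a b)` with
`h₇ = limitExtension_pullbackGlue_of_specialisation hS : PullbackGlue` and
`h₈ = limitExtension_middleDivisorSupportSuffices_of_divisorInduction_of_oddBelowMiddle hDI hG`.
[cite: Thomas2005Nodes, Prop. 2 (proof)] [cite: BrosnanFangNiePearlstein2009, §6 Lemma 48]
[cite: DeligneHodgeIII1974, Cor. 8.2.8] -/
theorem limitExtension_assembly_of_divisorInduction_of_oddBelowMiddle
    (hS : SpecialisationOfAlgebraicity)
    (hDI : ∀ (n p : ℕ), 1 ≤ p →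
      (∀ ⦃Y : SchemeOver ℂ⦄, IsSmoothProjective n Y → ∀ c : complexBetti Y (2 * (p - 1)),
        IsRationalClass c → IsOfHodgeType n Y (2 * (p - 1)) (p - 1) (p - 1) c →
          c ∈ algebraicClasses Y (p - 1)) →
      ∀ ⦃X : SchemeOver ℂ⦄, IsSmoothProjective (n + 1) X → ∀ c : complexBetti X (2 * p),
        IsRationalClass c → IsOfHodgeType (n + 1) X (2 * p) p p c →
          c ∈ supportedClasses X (2 * p) 1 → c ∈ algebraicClasses X p)
    (hG : ∀ ⦃k : ℕ⦄ ⦃Y : SchemeOver ℂ⦄, IsSmoothProjective (2 * k + 1) Y →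
      ∀ c : complexBetti Y (2 * k), IsRationalClass c → IsOfHodgeType (2 * k + 1) Y (2 * k) k k c →
        c ∈ algebraicClasses Y k) :
    Assembly :=
  fun hM a b ↦ limitExtension_middleDivisorSupportSuffices_of_divisorInduction_of_oddBelowMiddle hDI hG
    hM (limitExtension_pullbackGlue_of_specialisation hS a b)

/-- `HodgeConjecture →` HC one below the middle in odd dimension (the family `hG` is a set of
instances of the summit: the cycle conjunct of `HodgeConjectureFor (2k+1) Y` in codimension `k`).
[cite: Deligne2000, §1] -/
theorem limitExtension_oddBelowMiddle_of_hodgeConjecture (h : _root_.HodgeConjecture) :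
    ∀ ⦃k : ℕ⦄ ⦃Y : SchemeOver ℂ⦄, IsSmoothProjective (2 * k + 1) Y →
      ∀ c : complexBetti Y (2 * k), IsRationalClass c → IsOfHodgeType (2 * k + 1) Y (2 * k) k k c →
        c ∈ algebraicClasses Y k :=
  fun k _ hY c hc hkk ↦ (h hY).2 k c hc hkk

/-- **What the item is worth beyond its two cruxes.**  Modulo the specialisation lemma `hS`
(stmt-HodgeConjecture-2998) and the divisor induction `hDI` (stmt-HodgeConjecture-1082), both of
them theorems in print, `Assembly ↔ (LimitExtensionMid → HypersurfaceHodge → HC one below the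
middle in odd dimension)`: forward because `Assembly` yields the whole Hodge conjecture (its models antecedent
discharged by `nonempty_hodgeModel_holds`), backward by
`limitExtension_assembly_of_divisorInduction_of_oddBelowMiddle`.  In Thomas's scheme the right-hand
family is the output of the Lefschetz-pencil step (`PencilReduction`, stmt-HodgeConjecture-1083);
for this route it is the only use of that step. [cite: Thomas2005Nodes, Prop. 2 (proof)]
[cite: BrosnanFangNiePearlstein2009, §6 Lemma 48] -/
theorem limitExtension_assembly_iff_oddBelowMiddle (hS : SpecialisationOfAlgebraicity)
    (hDI : ∀ (n p : ℕ), 1 ≤ p →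
      (∀ ⦃Y : SchemeOver ℂ⦄, IsSmoothProjective n Y → ∀ c : complexBetti Y (2 * (p - 1)),
        IsRationalClass c → IsOfHodgeType n Y (2 * (p - 1)) (p - 1) (p - 1) c →
          c ∈ algebraicClasses Y (p - 1)) →
      ∀ ⦃X : SchemeOver ℂ⦄, IsSmoothProjective (n + 1) X → ∀ c : complexBetti X (2 * p),
        IsRationalClass c → IsOfHodgeType (n + 1) X (2 * p) p p c →
          c ∈ supportedClasses X (2 * p) 1 → c ∈ algebraicClasses X p) :
    Assembly ↔ (LimitExtensionMid → HypersurfaceHodge →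
      ∀ ⦃k : ℕ⦄ ⦃Y : SchemeOver ℂ⦄, IsSmoothProjective (2 * k + 1) Y →
        ∀ c : complexBetti Y (2 * k), IsRationalClass c →
          IsOfHodgeType (2 * k + 1) Y (2 * k) k k c → c ∈ algebraicClasses Y k) := by
  constructor
  · intro h a b
    exact limitExtension_oddBelowMiddle_of_hodgeConjecture (h (fun _ _ hX ↦ nonempty_hodgeModel_holds hX) a b)
  · intro h hM a b
    exact limitExtension_assembly_of_divisorInduction_of_oddBelowMiddle hS hDI (h a b) hM a b

/-- **Item stmt-HodgeConjecture-10865 beyond the divisor induction.**  Modulo `hDI` (the body of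
`DivisorInduction`, stmt-HodgeConjecture-1082), `MiddleDivisorSupportSuffices ↔
(MiddleDivisorSupport → HC one below the middle in odd dimension)` — compare
`limitExtension_middleDivisorSupportSuffices_iff` (`↔ (MiddleDivisorSupport →` HC in the middle
degree of EVEN-dimensional varieties`)`, BFNP Lemma 48 alone): granted middle divisor support and
the divisor induction, the Hodge conjecture is equivalent to its instances one below the middle in
ODD dimension, which is what the Lefschetz-pencil step (`PencilReduction`, stmt-HodgeConjecture-1083)
is for. [cite: Thomas2005Nodes, Prop. 2 (proof)] [cite: BrosnanFangNiePearlstein2009, §6 Lemma 48] -/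
theorem limitExtension_middleDivisorSupportSuffices_iff_oddBelowMiddle
    (hDI : ∀ (n p : ℕ), 1 ≤ p →
      (∀ ⦃Y : SchemeOver ℂ⦄, IsSmoothProjective n Y → ∀ c : complexBetti Y (2 * (p - 1)),
        IsRationalClass c → IsOfHodgeType n Y (2 * (p - 1)) (p - 1) (p - 1) c →
          c ∈ algebraicClasses Y (p - 1)) →
      ∀ ⦃X : SchemeOver ℂ⦄, IsSmoothProjective (n + 1) X → ∀ c : complexBetti X (2 * p),
        IsRationalClass c → IsOfHodgeType (n + 1) X (2 * p) p p c →
          c ∈ supportedClasses X (2 * p) 1 → c ∈ algebraicClasses X p) :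
    MiddleDivisorSupportSuffices ↔ (MiddleDivisorSupport →
      ∀ ⦃k : ℕ⦄ ⦃Y : SchemeOver ℂ⦄, IsSmoothProjective (2 * k + 1) Y →
        ∀ c : complexBetti Y (2 * k), IsRationalClass c →
          IsOfHodgeType (2 * k + 1) Y (2 * k) k k c → c ∈ algebraicClasses Y k) := by
  constructor
  · intro h hMDS
    exact limitExtension_oddBelowMiddle_of_hodgeConjecture
      (h (fun _ _ hX ↦ nonempty_hodgeModel_holds hX) hMDS)
  · intro h hM hMDS
    exact limitExtension_middleDivisorSupportSuffices_of_divisorInduction_of_oddBelowMiddle hDI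
      (h hMDS) hM hMDS

/-- **The item on the LEAVES of the tree's fact DAG.**  Hypotheses: Deligne's *Hodge III*
Prop. 8.2.7 (`h827`, the named fact `Deligne1974_ker_pullback_eq_ker_pullback_resolution`; ⟹
Cor. 8.2.8 by `Deligne1974_ker_restrictCompl_eq_iSup_range_complexGysin_holds_of`), the
polarizability of the Hodge structures of smooth projective varieties (`hpol`, the named fact
`smoothProjective_hodgeStructure_isPolarizable`; ⟹ Voisin 2025 Cor. 2.12 by
`Voisin2025_hodgeClass_lift_complexGysin_holds_of` with the theorems `exists_isReal_hodgeModel_holds`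
and `exists_deRhamIsoFamily_holds`), the route's specialisation lemma (`hS`,
stmt-HodgeConjecture-2998) and HC one below the middle in odd dimension (`hG`).  The divisor
induction is then the Literature theorem `divisorInduction_of_deligne_of_hodgeClassLift`.
[cite: DeligneHodgeIII1974, Prop. 8.2.7 and Cor. 8.2.8] [cite: Voisin2025, Prop. 2.11 and Cor. 2.12]
[cite: Thomas2005Nodes, Prop. 2 (proof)] -/
theorem limitExtension_assembly_of_leaves (h827 : Deligne1974_ker_pullback_eq_ker_pullback_resolution)
    (hpol : smoothProjective_hodgeStructure_isPolarizable) (hS : SpecialisationOfAlgebraicity)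
    (hG : ∀ ⦃k : ℕ⦄ ⦃Y : SchemeOver ℂ⦄, IsSmoothProjective (2 * k + 1) Y →
      ∀ c : complexBetti Y (2 * k), IsRationalClass c → IsOfHodgeType (2 * k + 1) Y (2 * k) k k c →
        c ∈ algebraicClasses Y k) :
    Assembly :=
  limitExtension_assembly_of_divisorInduction_of_oddBelowMiddle hS
    (divisorInduction_of_deligne_of_hodgeClassLift
      (Deligne1974_ker_restrictCompl_eq_iSup_range_complexGysin_holds_of h827)
      (Voisin2025_hodgeClass_lift_complexGysin_holds_of exists_isReal_hodgeModel_holds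
        (fun E _ _ _ ↦ Literature.NumberTheory.Transcendental.exists_deRhamIsoFamily_holds E) hpol))
    hG

/-- **The item on the leaves, pencil form** (the planner's intended chain): the same two named
facts `h827`, `hpol`, the specialisation lemma `hS` (stmt-HodgeConjecture-2998), and the
Lefschetz-pencil step below the middle `hPen` — verbatim the body of `PencilReduction`
(stmt-HodgeConjecture-1083; Thomas 2005, proof of Prop. 2) — give `Assembly`: the planner's
composition `fun m a b ↦ h₈ m (h₇ a b)` with `h₇ = limitExtension_pullbackGlue_of_specialisation hS`
and `h₈ = middleDivisorSupportSuffices_of_facts _ _ hPen`. [cite: Thomas2005Nodes, Prop. 2 (proof)]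
[cite: DeligneHodgeIII1974, Prop. 8.2.7 and Cor. 8.2.8] [cite: Voisin2025, Cor. 2.12] -/
theorem limitExtension_assembly_of_leaves_of_pencilReduction
    (h827 : Deligne1974_ker_pullback_eq_ker_pullback_resolution)
    (hpol : smoothProjective_hodgeStructure_isPolarizable) (hS : SpecialisationOfAlgebraicity)
    (hPen : ∀ (m p : ℕ), 1 ≤ p → 2 * p ≤ m →
      (∀ ⦃Y : SchemeOver ℂ⦄, IsSmoothProjective m Y → ∀ (q : ℕ) (c : complexBetti Y (2 * q)),
        IsRationalClass c → IsOfHodgeType m Y (2 * q) q q c → c ∈ algebraicClasses Y q) →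
      (∀ ⦃X' : SchemeOver ℂ⦄, IsSmoothProjective (m + 1) X' →
        ∀ c : complexBetti X' (2 * (p - 1)), IsRationalClass c →
          IsOfHodgeType (m + 1) X' (2 * (p - 1)) (p - 1) (p - 1) c → c ∈ algebraicClasses X' (p - 1)) →
      ∀ ⦃X : SchemeOver ℂ⦄, IsSmoothProjective (m + 1) X → ∀ c : complexBetti X (2 * p),
        IsRationalClass c → IsOfHodgeType (m + 1) X (2 * p) p p c → c ∈ algebraicClasses X p) :
    Assembly :=
  fun hM a b ↦ middleDivisorSupportSuffices_of_facts
    (Deligne1974_ker_restrictCompl_eq_iSup_range_complexGysin_holds_of h827)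
    (Voisin2025_hodgeClass_lift_complexGysin_holds_of exists_isReal_hodgeModel_holds
      (fun E _ _ _ ↦ Literature.NumberTheory.Transcendental.exists_deRhamIsoFamily_holds E) hpol)
    hPen hM (limitExtension_pullbackGlue_of_specialisation hS a b)

end Summit.HodgeConjecture.HodgeConjecture.Theorems

end
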